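import Mathlib

/-!
# The universal (Buchsbaum–Rim ∕ Cramer) syzygy of an `(r+1) × r` matrix

Algebraic core of PROPOSITION BR of the pub-hsemireg cell note ZSEARCH-NOTE-search-1 §13 (corner 1,
S4-PUSH): for any `(r+1) × r` matrix `M` over a commutative ring, the row of signed maximal minors
`w i = (-1)^i · det (M with row i deleted)` satisfies `w · M = 0`.  Applied to the entry matrix of a
block of an honest complex of line bundles (entries = sections, products in the symmetric algebra of
sections), this is the identity `X · E = 0` that makes the Buchsbaum–Rim exits honest for ANY choice of
entry sections; the class law `[y_T] = Σ_T [m] − Σ_k [x_k]` is then mere additivity of degrees.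
Pure linear algebra over `CommRing`; nothing here is specific to abelian varieties, and nothing here
bears on HC ∕ HC_CM ∕ HC_AV.  Count-neutral infrastructure.
-/

namespace Summit.Ventures.HSemireg.GenericSyzygy

open Matrix

variable {R : Type*} [CommRing R] {r : ℕ}

/-- **Cramer ∕ Buchsbaum–Rim syzygy.** For an `(r+1) × r` matrix `M` over a commutative ring and every
column `k`, `∑ i, (-1)^i · det (M.submatrix i.succAbove id) · M i k = 0`: the signed maximal minors
form a row vector killing `M`.  Proof: the sum is the Laplace expansion along column `0` of the square
matrix `[M_k | M]`, which has two equal columns. [cite: Eisenbud1995, §A2.6 (Buchsbaum–Rim complex), first differential] -/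
theorem sum_signedMinor_mul_eq_zero (M : Matrix (Fin (r + 1)) (Fin r) R) (k : Fin r) :
    ∑ i : Fin (r + 1), (-1) ^ (i : ℕ) * (M.submatrix i.succAbove id).det * M i k = 0 := by
  -- the square matrix whose column `0` is column `k` of `M` and whose column `j.succ` is column `j`
  let A : Matrix (Fin (r + 1)) (Fin (r + 1)) R :=
    Matrix.of fun i j => Fin.cases (M i k) (fun j' => M i j') j
  have hcol : ∀ i, A i 0 = A i k.succ := by
    intro i
    simp [A]
  have hA : A.det = 0 := Matrix.det_zero_of_column_eq (Fin.succ_ne_zero k).symm hcol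
  have hsub : ∀ i : Fin (r + 1), A.submatrix i.succAbove Fin.succ = M.submatrix i.succAbove id := by
    intro i
    ext a b
    simp [A, Matrix.submatrix]
  have hexp := Matrix.det_succ_column_zero A
  rw [hA] at hexp
  -- `0 = ∑ i, (-1)^i * A i 0 * det (A.submatrix i.succAbove Fin.succ)`
  have h0 : ∀ i : Fin (r + 1), A i 0 = M i k := by
    intro i
    simp [A]
  calc ∑ i : Fin (r + 1), (-1) ^ (i : ℕ) * (M.submatrix i.succAbove id).det * M i k
      = ∑ i : Fin (r + 1), (-1) ^ (i : ℕ) * A i 0 * (A.submatrix i.succAbove Fin.succ).det := by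
        refine Finset.sum_congr rfl fun i _ => ?_
        rw [hsub i, h0 i]
        ring
    _ = 0 := hexp.symm

/-- Row-vector form: the signed maximal minors `w` of an `(r+1) × r` matrix satisfy `w ᵥ* M = 0`.
[cite: Eisenbud1995, §A2.6] -/
theorem signedMinor_vecMul_eq_zero (M : Matrix (Fin (r + 1)) (Fin r) R) :
    Matrix.vecMul (fun i : Fin (r + 1) => (-1) ^ (i : ℕ) * (M.submatrix i.succAbove id).det) M = 0 := by
  funext k
  simp only [Matrix.vecMul, dotProduct, Pi.zero_apply]
  exact sum_signedMinor_mul_eq_zero M k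

/-- **The exit row supported on an `(r+1)`-subset of the middles.** For an `f × r` entry matrix `E`
(sources `k : Fin r`, middles `a : Fin f`) and any `(r+1)`-tuple of middles `T : Fin (r+1) → Fin f`,
the row `w^{(T)}` with `w^{(T)}_{T i} = (-1)^i · det (E restricted to the rows T ∘ i.succAbove)` kills
every column of `E` restricted to the rows of `T`: `∑ i, w^{(T)}_{T i} · E (T i) k = 0`.  (If `T` is not
injective the minors vanish in pairs and the statement is still true.)  This is the slot identity
`Σ_m X_{ym} E_{mx} = 0` of an honest block with Buchsbaum–Rim exits, for every choice of entries.
[cite: Eisenbud1995, §A2.6] -/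
theorem sum_signedMinor_rows_mul_eq_zero {f : ℕ} (E : Matrix (Fin f) (Fin r) R)
    (T : Fin (r + 1) → Fin f) (k : Fin r) :
    ∑ i : Fin (r + 1), (-1) ^ (i : ℕ) * ((E.submatrix T id).submatrix i.succAbove id).det * E (T i) k
      = 0 := by
  have h := sum_signedMinor_mul_eq_zero (E.submatrix T id) k
  simpa [Matrix.submatrix] using h

end Summit.Ventures.HSemireg.GenericSyzygy
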